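import Literature.MathematicalPhysics.QuantumFieldTheory.CurvatureGaussianField
import HarnessLib

/-!
# Block Green one-form of a plaquette, I: curl algebra and the codifferential pairing (support file of stub `stub_blockGreen`)

Route `SteinGapBootstrap` of `YangMills`, crux U = `Theses.SteinGapBootstrap.FreeProbeLawG`
(stmt-QuantumFields-23756), line `birth` (RESHAPE 2, lead `ym-line-sgb-k1`), registered stub
`stub_blockGreen` (pure lattice potential theory on `ℤ⁴`, no gauge theory). This file and its sequel
(`SteinGapBootstrapFreeProbeLawGBlockGreenHodge`) prove the EXACT (analysis-free, every `d`) identities behind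
that stub, for the Green one-form of a plaquette `p`, `ω_p(e) = ∑ₐ σₐ Γ(∂ₐ p, e)` (`Γ = edgeGreen`, the Green
kernel of `-Δ` on `1`-forms), i.e. `ω_p = Γ d^* δ_p`. Here:

* linearity of the lattice curl `plaquetteCurl` (`d`), the decomposition of a finitely supported `1`-form into
  edge indicators and the resulting finite summation by parts `∑_q F(q)(dA)(q) = ∑_f A(f) ∑_q F(q)(dδ_f)(q)`;
* `plaquetteCurl_greenForm` — `d ω_p = curvatureTwoPoint p ·` (the definition of the two-plaquette kernel
  `Π = d Γ d^*`);
* `sum_plaquetteCurl_single_mul` — the lattice codifferential written as a pairing: for a `2`-form `F` and an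
  edge `e = (y, k)`, `⟨d δ_e, F⟩ = ∑_{q ∋ e} σ(q, e) F(q)`, listed over the `2(d-1)` plaquettes containing `e`
  (`(y; k<j)`, `(y - eⱼ; j<k)` with sign `+`, `(y - eⱼ; k<j)`, `(y; j<k)` with sign `-`).

All statements are written with explicit lambdas (no new definitions). HONEST LABEL: route SteinGapBootstrap
closes the RECORD rung R2ξ-G (`WeakCouplingRates.XiPow`) conditionally on U; nothing here bears on the
Yang–Mills mass gap itself.
-/

open Finset
open Literature.MathematicalPhysics.QuantumFieldTheory Literature.MathematicalPhysics.QuantumLattice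
  Literature.Probability.LatticeModels

namespace Summit.QuantumFields.YangMills.Theorems.SteinGapBootstrap.BlockGreen

variable {d : ℕ}
/-! ### Linearity of the lattice curl -/

/-- The curl of a sum of `1`-forms. -/
theorem plaquetteCurl_add (A B : ZdEdge d → ℝ) (q : ZdPlaquette d) :
    plaquetteCurl (fun e => A e + B e) q = plaquetteCurl A q + plaquetteCurl B q := by
  simp only [plaquetteCurl, mul_add, Finset.sum_add_distrib]

/-- The curl of a difference of `1`-forms. -/
theorem plaquetteCurl_sub (A B : ZdEdge d → ℝ) (q : ZdPlaquette d) :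
    plaquetteCurl (fun e => A e - B e) q = plaquetteCurl A q - plaquetteCurl B q := by
  simp only [plaquetteCurl, mul_sub, Finset.sum_sub_distrib]

/-- The curl of a scalar multiple of a `1`-form. -/
theorem plaquetteCurl_const_mul (c : ℝ) (A : ZdEdge d → ℝ) (q : ZdPlaquette d) :
    plaquetteCurl (fun e => c * A e) q = c * plaquetteCurl A q := by
  simp only [plaquetteCurl, Finset.mul_sum]
  exact Finset.sum_congr rfl fun a _ => by ring

/-- The curl of a finite linear combination of `1`-forms. -/
theorem plaquetteCurl_finset_sum {ι : Type*} (s : Finset ι) (B : ι → ZdEdge d → ℝ)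
    (q : ZdPlaquette d) :
    plaquetteCurl (fun e => ∑ i ∈ s, B i e) q = ∑ i ∈ s, plaquetteCurl (B i) q := by
  simp only [plaquetteCurl, Finset.mul_sum]
  rw [Finset.sum_comm]

/-- The curl of the zero `1`-form vanishes. -/
theorem plaquetteCurl_zero_fun (q : ZdPlaquette d) : plaquetteCurl (fun _ => (0 : ℝ)) q = 0 := by
  simp [plaquetteCurl]

/-- `|dA(q)| ≤ ∑_b |A(∂_b q)|`. -/
theorem abs_plaquetteCurl_le (A : ZdEdge d → ℝ) (q : ZdPlaquette d) :
    |plaquetteCurl A q| ≤ ∑ b : Fin 4, |A (plaquetteBoundary q b)| := by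
  unfold plaquetteCurl
  refine (Finset.abs_sum_le_sum_abs _ _).trans (Finset.sum_le_sum fun b _ => ?_)
  rw [abs_mul]
  have : |plaquetteBoundarySign b| = 1 := by
    fin_cases b <;> simp [plaquetteBoundarySign]
  rw [this, one_mul]

/-- A `1`-form supported in a finite edge set `S` is the corresponding combination of edge indicators. -/
theorem eq_sum_indicator_of_support (A : ZdEdge d → ℝ) (S : Finset (ZdEdge d))
    (hS : ∀ e, A e ≠ 0 → e ∈ S) (e : ZdEdge d) :
    A e = ∑ f ∈ S, A f * (if e = f then (1 : ℝ) else 0) := by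
  by_cases he : e ∈ S
  · rw [Finset.sum_eq_single_of_mem e he]
    · simp
    · intro f _ hfe
      simp [Ne.symm hfe]
  · have hA : A e = 0 := by
      by_contra h
      exact he (hS e h)
    rw [hA, eq_comm]
    refine Finset.sum_eq_zero fun f hf => ?_
    have : e ≠ f := fun h => he (h ▸ hf)
    simp [this]

/-- Curl of a finitely supported `1`-form as a combination of curls of edge indicators. -/
theorem plaquetteCurl_eq_sum_of_support (A : ZdEdge d → ℝ) (S : Finset (ZdEdge d))
    (hS : ∀ e, A e ≠ 0 → e ∈ S) (q : ZdPlaquette d) :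
    plaquetteCurl A q =
      ∑ f ∈ S, A f * plaquetteCurl (fun e => if e = f then (1 : ℝ) else 0) q := by
  have h : plaquetteCurl A q =
      plaquetteCurl (fun e => ∑ f ∈ S, A f * (if e = f then (1 : ℝ) else 0)) q := by
    unfold plaquetteCurl
    refine Finset.sum_congr rfl fun a _ => ?_
    beta_reduce
    rw [← eq_sum_indicator_of_support A S hS]
  rw [h, plaquetteCurl_finset_sum]
  exact Finset.sum_congr rfl fun f _ => plaquetteCurl_const_mul _ _ _

/-- **Summation by parts against a finitely supported `1`-form**: for any `2`-form `F` and any finite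
set of plaquettes `T`, `∑_{q ∈ T} F(q) (dA)(q) = ∑_{f ∈ S} A(f) · ∑_{q ∈ T} F(q) (dδ_f)(q)`. -/
theorem sum_mul_plaquetteCurl_eq_sum_support (F : ZdPlaquette d → ℝ) (A : ZdEdge d → ℝ)
    (S : Finset (ZdEdge d)) (hS : ∀ e, A e ≠ 0 → e ∈ S) (T : Finset (ZdPlaquette d)) :
    ∑ q ∈ T, plaquetteCurl A q * F q =
      ∑ f ∈ S, A f * ∑ q ∈ T, plaquetteCurl (fun e => if e = f then (1 : ℝ) else 0) q * F q := by
  calc ∑ q ∈ T, plaquetteCurl A q * F q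
      = ∑ q ∈ T, ∑ f ∈ S, A f * (plaquetteCurl (fun e => if e = f then (1 : ℝ) else 0) q * F q) := by
        refine Finset.sum_congr rfl fun q _ => ?_
        rw [plaquetteCurl_eq_sum_of_support A S hS q, Finset.sum_mul]
        exact Finset.sum_congr rfl fun f _ => by ring
    _ = ∑ f ∈ S, A f * ∑ q ∈ T, plaquetteCurl (fun e => if e = f then (1 : ℝ) else 0) q * F q := by
        rw [Finset.sum_comm]
        exact Finset.sum_congr rfl fun f _ => by rw [Finset.mul_sum]

/-! ### The Green one-form of a plaquette and its curl -/

/-- **`dω_p = Π(p, ·)`**: the curl of the Green one-form `ω_p(e) = ∑ₐ σₐ Γ(∂ₐ p, e)` of the plaquette `p`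
at the plaquette `q` is the two-plaquette kernel `curvatureTwoPoint p q = (dΓd^*)(p, q)`. -/
theorem plaquetteCurl_greenForm (p q : ZdPlaquette d) :
    plaquetteCurl (fun e => ∑ a : Fin 4, plaquetteBoundarySign a * edgeGreen (plaquetteBoundary p a) e) q =
      curvatureTwoPoint p q := by
  rw [plaquetteCurl_finset_sum]
  unfold curvatureTwoPoint
  refine Finset.sum_congr rfl fun a _ => ?_
  rw [plaquetteCurl_const_mul, plaquetteCurl, Finset.mul_sum]
  exact Finset.sum_congr rfl fun b _ => by ring

/-! ### The codifferential as a pairing: enumerating the plaquettes through an edge -/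

/-- Reindexing lemma: a sum over `T` of `F` restricted to the elements satisfying `P` equals the sum over a
parametrisation `φ` of `{a | P a}` by the indices `i` with `c i` (all parametrised elements lying in `T`). -/
theorem sum_ite_eq_sum_dite_of_param {α ι : Type*} [DecidableEq α] [Fintype ι] (T : Finset α)
    (F : α → ℝ) (P : α → Prop) [DecidablePred P] (c : ι → Prop) [DecidablePred c]
    (φ : ∀ i, c i → α) (hmem : ∀ i (h : c i), φ i h ∈ T) (hP : ∀ i (h : c i), P (φ i h))
    (hinj : ∀ i i' (h : c i) (h' : c i'), φ i h = φ i' h' → i = i')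
    (hsurj : ∀ a, P a → ∃ i, ∃ h : c i, φ i h = a) :
    ∑ a ∈ T, (if P a then F a else 0) = ∑ i, (if h : c i then F (φ i h) else 0) := by
  classical
  have step : ∀ i, (if h : c i then F (φ i h) else 0) =
      ∑ a ∈ T, (if h : c i then (if a = φ i h then F a else 0) else 0) := by
    intro i
    by_cases hc : c i
    · simp only [hc, dif_pos]
      rw [Finset.sum_ite_eq' T (φ i hc) F, if_pos (hmem i hc)]
    · simp [hc]
  simp_rw [step]
  rw [Finset.sum_comm]
  refine Finset.sum_congr rfl fun a _ => ?_
  by_cases hPa : P a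
  · rw [if_pos hPa]
    obtain ⟨i₀, h₀, hi₀⟩ := hsurj a hPa
    rw [Finset.sum_eq_single i₀]
    · rw [dif_pos h₀, if_pos hi₀.symm]
    · intro i _ hi
      by_cases hc : c i
      · rw [dif_pos hc, if_neg]
        intro hai
        exact hi (hinj i i₀ hc h₀ (by rw [← hai, hi₀]))
      · rw [dif_neg hc]
    · intro h
      exact absurd (Finset.mem_univ i₀) h
  · rw [if_neg hPa]
    symm
    refine Finset.sum_eq_zero fun i _ => ?_
    by_cases hc : c i
    · rw [dif_pos hc, if_neg]
      intro hai
      exact hPa (hai ▸ hP i hc)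
    · rw [dif_neg hc]

/-- The four boundary edges of a plaquette, membership form. -/
theorem plaquetteBoundary_mem_plaquetteEdges (q : ZdPlaquette d) (b : Fin 4) :
    plaquetteBoundary q b ∈ plaquetteEdges q := by
  rw [← image_plaquetteBoundary]
  exact Finset.mem_image_of_mem _ (Finset.mem_univ b)

/-- Boundary edge `0` of `q = (x; i < j)` is `(x, i)`: it equals `(y, k)` iff `q = (y; k < j)` for some `j > k`. -/
theorem sum_ite_boundary_zero (F : ZdPlaquette d → ℝ) (y : Site d) (k : Fin d)
    (T : Finset (ZdPlaquette d)) (hT : ∀ q : ZdPlaquette d, (y, k) ∈ plaquetteEdges q → q ∈ T) :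
    ∑ q ∈ T, (if plaquetteBoundary q 0 = (y, k) then F q else 0) =
      ∑ j : Fin d, (if h : k < j then F (y, ⟨(k, j), h⟩) else 0) := by
  refine sum_ite_eq_sum_dite_of_param T F (fun q => plaquetteBoundary q 0 = (y, k)) (fun j => k < j)
    (fun j h => (y, ⟨(k, j), h⟩)) ?_ ?_ ?_ ?_
  · intro j h
    refine hT _ ?_
    have := plaquetteBoundary_mem_plaquetteEdges (d := d) (y, ⟨(k, j), h⟩) 0
    simpa [plaquetteBoundary] using this
  · intro j h
    simp [plaquetteBoundary]
  · intro j j' h h' hjj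
    have := congrArg (fun q : ZdPlaquette d => q.2.1.2) hjj
    simpa using this
  · rintro ⟨x, ⟨⟨i, j⟩, hij⟩⟩ hq
    simp only [plaquetteBoundary, Matrix.cons_val_zero, Prod.mk.injEq] at hq
    obtain ⟨rfl, rfl⟩ := hq
    exact ⟨j, hij, rfl⟩

/-- Boundary edge `1` of `q = (x; i < j)` is `(x + eᵢ, j)`: it equals `(y, k)` iff `q = (y - eᵢ; i < k)`. -/
theorem sum_ite_boundary_one (F : ZdPlaquette d → ℝ) (y : Site d) (k : Fin d)
    (T : Finset (ZdPlaquette d)) (hT : ∀ q : ZdPlaquette d, (y, k) ∈ plaquetteEdges q → q ∈ T) :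
    ∑ q ∈ T, (if plaquetteBoundary q 1 = (y, k) then F q else 0) =
      ∑ j : Fin d, (if h : j < k then F (y - Pi.single j 1, ⟨(j, k), h⟩) else 0) := by
  refine sum_ite_eq_sum_dite_of_param T F (fun q => plaquetteBoundary q 1 = (y, k)) (fun j => j < k)
    (fun j h => (y - Pi.single j 1, ⟨(j, k), h⟩)) ?_ ?_ ?_ ?_
  · intro j h
    refine hT _ ?_
    have := plaquetteBoundary_mem_plaquetteEdges (d := d) (y - Pi.single j 1, ⟨(j, k), h⟩) 1
    simpa [plaquetteBoundary] using this
  · intro j h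
    simp [plaquetteBoundary]
  · intro j j' h h' hjj
    have := congrArg (fun q : ZdPlaquette d => q.2.1.1) hjj
    simpa using this
  · rintro ⟨x, ⟨⟨i, j⟩, hij⟩⟩ hq
    simp only [plaquetteBoundary, Matrix.cons_val_one, Matrix.cons_val_zero, Prod.mk.injEq] at hq
    obtain ⟨hx, rfl⟩ := hq
    refine ⟨i, hij, ?_⟩
    simp only [Prod.mk.injEq, and_true]
    rw [← hx, add_sub_cancel_right]

/-- Boundary edge `2` of `q = (x; i < j)` is `(x + eⱼ, i)`: it equals `(y, k)` iff `q = (y - eⱼ; k < j)`. -/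
theorem sum_ite_boundary_two (F : ZdPlaquette d → ℝ) (y : Site d) (k : Fin d)
    (T : Finset (ZdPlaquette d)) (hT : ∀ q : ZdPlaquette d, (y, k) ∈ plaquetteEdges q → q ∈ T) :
    ∑ q ∈ T, (if plaquetteBoundary q 2 = (y, k) then F q else 0) =
      ∑ j : Fin d, (if h : k < j then F (y - Pi.single j 1, ⟨(k, j), h⟩) else 0) := by
  refine sum_ite_eq_sum_dite_of_param T F (fun q => plaquetteBoundary q 2 = (y, k)) (fun j => k < j)
    (fun j h => (y - Pi.single j 1, ⟨(k, j), h⟩)) ?_ ?_ ?_ ?_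
  · intro j h
    refine hT _ ?_
    have := plaquetteBoundary_mem_plaquetteEdges (d := d) (y - Pi.single j 1, ⟨(k, j), h⟩) 2
    simpa [plaquetteBoundary] using this
  · intro j h
    simp [plaquetteBoundary]
  · intro j j' h h' hjj
    have := congrArg (fun q : ZdPlaquette d => q.2.1.2) hjj
    simpa using this
  · rintro ⟨x, ⟨⟨i, j⟩, hij⟩⟩ hq
    simp only [plaquetteBoundary, Matrix.cons_val_two, Matrix.tail_cons, Matrix.head_cons,
      Prod.mk.injEq] at hq
    obtain ⟨hx, rfl⟩ := hq
    refine ⟨j, hij, ?_⟩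
    simp only [Prod.mk.injEq, and_true]
    rw [← hx, add_sub_cancel_right]

/-- Boundary edge `3` of `q = (x; i < j)` is `(x, j)`: it equals `(y, k)` iff `q = (y; i < k)`. -/
theorem sum_ite_boundary_three (F : ZdPlaquette d → ℝ) (y : Site d) (k : Fin d)
    (T : Finset (ZdPlaquette d)) (hT : ∀ q : ZdPlaquette d, (y, k) ∈ plaquetteEdges q → q ∈ T) :
    ∑ q ∈ T, (if plaquetteBoundary q 3 = (y, k) then F q else 0) =
      ∑ j : Fin d, (if h : j < k then F (y, ⟨(j, k), h⟩) else 0) := by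
  refine sum_ite_eq_sum_dite_of_param T F (fun q => plaquetteBoundary q 3 = (y, k)) (fun j => j < k)
    (fun j h => (y, ⟨(j, k), h⟩)) ?_ ?_ ?_ ?_
  · intro j h
    refine hT _ ?_
    have := plaquetteBoundary_mem_plaquetteEdges (d := d) (y, ⟨(j, k), h⟩) 3
    simpa [plaquetteBoundary] using this
  · intro j h
    simp [plaquetteBoundary]
  · intro j j' h h' hjj
    have := congrArg (fun q : ZdPlaquette d => q.2.1.1) hjj
    simpa using this
  · rintro ⟨x, ⟨⟨i, j⟩, hij⟩⟩ hq
    simp only [plaquetteBoundary, Matrix.cons_val_three, Matrix.tail_cons, Matrix.head_cons,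
      Prod.mk.injEq] at hq
    obtain ⟨rfl, rfl⟩ := hq
    exact ⟨i, hij, rfl⟩

/-- **The codifferential as a pairing.** For a `2`-form `F`, an edge `e = (y, k)` and any finite set `T` of
plaquettes containing every plaquette through `e`:
`⟨dδ_e, F⟩_T = ∑_{q ∈ T} (dδ_e)(q) F(q) = ∑ⱼ [ F(y; k<j) + F(y - eⱼ; j<k) - F(y - eⱼ; k<j) - F(y; j<k) ]`
(the `2(d-1)` plaquettes containing `e`, with their incidence signs). -/
theorem sum_plaquetteCurl_single_mul (F : ZdPlaquette d → ℝ) (y : Site d) (k : Fin d)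
    (T : Finset (ZdPlaquette d)) (hT : ∀ q : ZdPlaquette d, (y, k) ∈ plaquetteEdges q → q ∈ T) :
    ∑ q ∈ T, plaquetteCurl (fun e => if e = (y, k) then (1 : ℝ) else 0) q * F q =
      ∑ j : Fin d,
        (((if h : k < j then F (y, ⟨(k, j), h⟩) else 0)
          + (if h : j < k then F (y - Pi.single j 1, ⟨(j, k), h⟩) else 0))
          - ((if h : k < j then F (y - Pi.single j 1, ⟨(k, j), h⟩) else 0)
          + (if h : j < k then F (y, ⟨(j, k), h⟩) else 0))) := by
  have expand : ∀ q : ZdPlaquette d,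
      plaquetteCurl (fun e => if e = (y, k) then (1 : ℝ) else 0) q * F q =
        ((if plaquetteBoundary q 0 = (y, k) then F q else 0)
          + (if plaquetteBoundary q 1 = (y, k) then F q else 0))
          - ((if plaquetteBoundary q 2 = (y, k) then F q else 0)
          + (if plaquetteBoundary q 3 = (y, k) then F q else 0)) := by
    intro q
    simp only [plaquetteCurl, Fin.sum_univ_four, plaquetteBoundarySign, Matrix.cons_val_zero,
      Matrix.cons_val_one, Matrix.cons_val_two, Matrix.cons_val_three, Matrix.tail_cons,
      Matrix.head_cons]
    split_ifs <;> ring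
  simp_rw [expand]
  rw [Finset.sum_sub_distrib, Finset.sum_add_distrib, Finset.sum_add_distrib,
    sum_ite_boundary_zero F y k T hT, sum_ite_boundary_one F y k T hT,
    sum_ite_boundary_two F y k T hT, sum_ite_boundary_three F y k T hT,
    ← Finset.sum_add_distrib, ← Finset.sum_add_distrib, ← Finset.sum_sub_distrib]

end Summit.QuantumFields.YangMills.Theorems.SteinGapBootstrap.BlockGreen
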